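import Literature.Computability.QuantumComplexity.SimonFourier
import Mathlib.Logic.Equiv.Fin.Basic
import HarnessLib

/-!
# Simon's algorithm with an additive phase over `m` blocks: the Fourier sums

Family `facts` / discharge of `Literature.Computability.Complexity.fortnowGrochow_Ker_eq_PEq_UP_subset_BQP`
(Fortnow–Grochow 2011, Thm. 4.3: `Ker = PEq ⟹ UP ⊆ BQP`, by reduction to Simon's problem). The
quantum sampler used there is a `1`-fold Forrelation circuit `H^{⊗W} U_G H^{⊗W} |0^W⟩`
(`PhaseQueryKernel.lean`) on a register of `W = m (Q + r)` wires read as `m` blocks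
`(y_i, z_i) ∈ {0,1}^Q × {0,1}^r`, with the ADDITIVE phase `G(u) = ⊕_i z_i · g(y_i)` of a block
function `g : {0,1}^Q → {0,1}^r` — the phase-kickback form of `m` parallel runs of Simon's
subroutine Fourier-twice on `y ↦ g y` (Simon 1997, §3.1; Nielsen–Chuang 2010, §6.1.1: the phase
`(-1)^{z·g(y)}` is the bit oracle `|y⟩|w⟩ ↦ |y⟩|w ⊕ g(y)⟩` conjugated by Hadamards on the value
register). This file is the combinatorics of its output distribution, on top of the tree's
`SimonFourier.lean` (`twist`, `sum_twist`, `twist_xor_left`, `MissesBasis`,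
`card_filter_missesBasis_le`):

* the block structure (`blk`, `yOf`, `zOf`, `ξs`, `ζs`, the equivalences `eBlk`, `eYZ`, `eSV`) and
  the factorisation of the character `(-1)^{u·v}` over blocks (`twist_eq_prod_blocks`);
* `sgnBlk g u = ∏_i (-1)^{z_i · g(y_i)}`, the amplitude `amp g v = 2^{-W} ∑_u sgnBlk u (-1)^{u·v}`
  and the one-block sum `S1 g ξ ζ = ∑_{y : g y = ζ} (-1)^{y·ξ}`; **`amp_eq`**:
  `amp g v = 2^{-mQ} ∏_i S1 g (ξ_i v) (ζ_i v)` (the value registers decouple: `sum_z`, `sum_block`);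
* **the periodic case** (`g (y ⊕ s) = g y`, `s ≠ 0`): `S1 = 0` at every `ξ` with odd overlap with
  `s` (`S1_eq_zero_of_periodic`, Simon's pairing `y ↔ y ⊕ s`), hence `amp g v = 0` unless the samples
  `ξ_i v` miss a basis (`amp_eq_zero_of_periodic`);
* **the injective case**: `∑_ζ S1² = 2^Q` (`sum_S1_sq_of_injective`), hence
  `∑_{v : MissesBasis (ξ v)} amp² ≤ (2^Q − 1) 2^{(Q−1)m} / 2^{Qm}`
  (`sum_amp_sq_missesBasis_of_injective`, the union bound `card_filter_missesBasis_le`).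

## References

* D. R. Simon, *On the power of quantum computation*, SIAM J. Comput. 26 (1997) 1474–1483, §3.1
  (the two cases of Fourier-twice; the samples contain a basis with high probability) [Simon1997].
* L. Fortnow, J. A. Grochow, *Complexity classes of equivalence problems revisited*, Inform. and
  Comput. 209 (2011) 748–763 = arXiv:0907.4775, Thm. 4.3 [FortnowGrochow2011].
* M. A. Nielsen, I. L. Chuang, *Quantum Computation and Quantum Information*, CUP 2010, §1.4.4,
  §6.1.1 [NielsenChuang2010].
-/

noncomputable section

namespace Literature.Computability.QuantumComplexity

namespace SimonBlocks

open Finset Simon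

variable {Q r m : ℕ}

/-! ### Block structure of a register of `m (Q + r)` wires -/

/-- Block `i` (of `Q + r` wires) of a content of `m (Q + r)` wires: wires `i (Q+r), …, i (Q+r) + Q + r - 1`. [folklore] -/
def blk (u : Fin (m * (Q + r)) → Bool) (i : Fin m) : Fin (Q + r) → Bool := fun j => u (finProdFinEquiv (i, j))

/-- The first `Q` wires of a block (the query part `y`). [folklore] -/
def yOf (b : Fin (Q + r) → Bool) : Fin Q → Bool := fun j => b (Fin.castAdd r j)

/-- The last `r` wires of a block (the value part `z`). [folklore] -/
def zOf (b : Fin (Q + r) → Bool) : Fin r → Bool := fun j => b (Fin.natAdd Q j)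

/-- The contents as tuples of blocks. [folklore] -/
def eBlk : (Fin (m * (Q + r)) → Bool) ≃ (Fin m → Fin (Q + r) → Bool) :=
  ((Equiv.arrowCongr finProdFinEquiv (Equiv.refl Bool)).symm).trans (Equiv.curry _ _ _)

/-- `eBlk` lists the blocks. [folklore] -/
@[simp] theorem eBlk_apply (u : Fin (m * (Q + r)) → Bool) : eBlk u = blk u := rfl

/-- A block as its query part and its value part. [folklore] -/
def eYZ : (Fin (Q + r) → Bool) ≃ (Fin Q → Bool) × (Fin r → Bool) :=
  (Equiv.arrowCongr finSumFinEquiv (Equiv.refl Bool)).symm.trans (Equiv.sumArrowEquivProdArrow _ _ _)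

/-- The components of `eYZ`. [folklore] -/
@[simp] theorem eYZ_apply (b : Fin (Q + r) → Bool) : eYZ b = (yOf b, zOf b) := by
  ext j <;> simp [eYZ, yOf, zOf, Equiv.sumArrowEquivProdArrow, Equiv.arrowCongr]

/-- The query parts of the blocks of a content (the `m` samples `ξ₀, …, ξ_{m-1}`). [cite: Simon1997, §3.1] -/
def ξs (v : Fin (m * (Q + r)) → Bool) : Fin m → Fin Q → Bool := fun i => yOf (blk v i)

/-- The value parts of the blocks of a content. [folklore] -/
def ζs (v : Fin (m * (Q + r)) → Bool) : Fin m → Fin r → Bool := fun i => zOf (blk v i)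

/-- **The twist of two contents factorises over the blocks and their parts.** [folklore] -/
theorem twist_eq_prod_blocks (u v : Fin (m * (Q + r)) → Bool) :
    twist u v = ∏ i, (twist (yOf (blk u i)) (yOf (blk v i)) * twist (zOf (blk u i)) (zOf (blk v i))) := by
  unfold twist
  rw [← Fintype.prod_equiv finProdFinEquiv (fun p : Fin m × Fin (Q + r) => if u (finProdFinEquiv p) && v (finProdFinEquiv p) then (-1 : ℝ) else 1)
      _ (fun _ => rfl), Fintype.prod_prod_type]
  refine Finset.prod_congr rfl fun i _ => ?_
  rw [Fin.prod_univ_add]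
  rfl

/-! ### The phase sign and the amplitude -/

variable (g : (Fin Q → Bool) → (Fin r → Bool))

/-- **The phase sign of a content** for the block function `g`:
`(-1)^{∑_i z_i · g(y_i)}`. [cite: Simon1997, §3.1] -/
def sgnBlk (u : Fin (m * (Q + r)) → Bool) : ℝ := ∏ i, twist (zOf (blk u i)) (g (yOf (blk u i)))

/-- **The amplitude** of the content `v` after `H^{⊗W} · (phase) · H^{⊗W}` on `|0^W⟩`, `W = m (Q + r)`:
`2^{-W} ∑_u sgnBlk u · (-1)^{u·v}`. [cite: Simon1997, §3.1] [cite: NielsenChuang2010, §1.4.4] -/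
def amp (v : Fin (m * (Q + r)) → Bool) : ℝ := (1 / 2) ^ (m * (Q + r)) * ∑ u, sgnBlk g u * twist u v

/-- **The one-block Fourier sum** `S(ξ, ζ) = ∑_{y : g y = ζ} (-1)^{y·ξ}` (Simon's
`∑_{z : F z = a} (-1)^{z·y}`). [cite: Simon1997, §3.1] -/
def S1 (ξ : Fin Q → Bool) (ζ : Fin r → Bool) : ℝ := ∑ y : Fin Q → Bool, if g y = ζ then twist y ξ else 0

/-- Xoring with `t` is zero iff the arguments agree. [folklore] -/
theorem xor_eq_zero_iff {n : ℕ} (a t : Fin n → Bool) : (fun i => a i ^^ t i) = (fun _ => false) ↔ a = t := by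
  constructor
  · intro h; funext i; have := congrFun h i; simpa using this
  · rintro rfl; funext i; simp

/-- The sum over the value part of one block: `∑_z (-1)^{z·g(y)} (-1)^{z·ζ} = 2^r [g y = ζ]`.
[cite: Simon1997, §3.1] -/
theorem sum_z (y : Fin Q → Bool) (ζ : Fin r → Bool) :
    ∑ z : Fin r → Bool, twist z (g y) * twist z ζ = if g y = ζ then (2 : ℝ) ^ r else 0 := by
  have h : ∀ z : Fin r → Bool, twist z (g y) * twist z ζ = twist (fun i => g y i ^^ ζ i) z := fun z => by
    rw [twist_comm z, twist_comm z, twist_xor_left]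
  simp_rw [h]
  rw [sum_twist]
  by_cases hy : g y = ζ
  · rw [if_pos ((xor_eq_zero_iff _ _).2 hy), if_pos hy]
  · rw [if_neg (fun h' => hy ((xor_eq_zero_iff _ _).1 h')), if_neg hy]

/-- The sum over one block: `∑_{(y,z)} (-1)^{z·g(y)} (-1)^{y·ξ} (-1)^{z·ζ} = 2^r S(ξ, ζ)`. [cite: Simon1997, §3.1] -/
theorem sum_block (ξ : Fin Q → Bool) (ζ : Fin r → Bool) :
    ∑ b : Fin (Q + r) → Bool, twist (zOf b) (g (yOf b)) * (twist (yOf b) ξ * twist (zOf b) ζ) = (2 : ℝ) ^ r * S1 g ξ ζ := by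
  rw [← Fintype.sum_equiv eYZ.symm (fun p : (Fin Q → Bool) × (Fin r → Bool) => twist p.2 (g p.1) * (twist p.1 ξ * twist p.2 ζ)) _
      (fun p => by
        obtain ⟨y, z⟩ := p
        have e : (yOf (eYZ.symm (y, z)), zOf (eYZ.symm (y, z))) = (y, z) := by rw [← eYZ_apply, Equiv.apply_symm_apply]
        rw [Prod.mk.injEq] at e
        rw [e.1, e.2]), Fintype.sum_prod_type]
  simp only
  have h : ∀ y : Fin Q → Bool, (∑ z : Fin r → Bool, twist z (g y) * (twist y ξ * twist z ζ)) =
      twist y ξ * (if g y = ζ then (2 : ℝ) ^ r else 0) := fun y => by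
    rw [← sum_z g y ζ, Finset.mul_sum]
    exact Finset.sum_congr rfl fun z _ => by ring
  simp_rw [h]
  rw [S1, Finset.mul_sum]
  exact Finset.sum_congr rfl fun y _ => by split_ifs <;> ring

/-- **The amplitude is a product of one-block sums**: `amp v = 2^{-mQ} ∏_i S(ξ_i, ζ_i)`.
[cite: Simon1997, §3.1] -/
theorem amp_eq (v : Fin (m * (Q + r)) → Bool) : amp g v = (1 / 2) ^ (m * Q) * ∏ i, S1 g (ξs v i) (ζs v i) := by
  unfold amp
  have hsum : (∑ u, sgnBlk g u * twist u v) =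
      ∑ w : Fin m → Fin (Q + r) → Bool, ∏ i, twist (zOf (w i)) (g (yOf (w i))) * (twist (yOf (w i)) (ξs v i) * twist (zOf (w i)) (ζs v i)) := by
    rw [← Fintype.sum_equiv eBlk.symm _ (fun u => sgnBlk g u * twist u v) (fun w => rfl)]
    refine Finset.sum_congr rfl fun w _ => ?_
    rw [sgnBlk, twist_eq_prod_blocks, ← Finset.prod_mul_distrib]
    simp only [← eBlk_apply, Equiv.apply_symm_apply]
    rfl
  rw [hsum]
  have hprod := Finset.prod_univ_sum (fun _ : Fin m => (Finset.univ : Finset (Fin (Q + r) → Bool)))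
    (fun i b => twist (zOf b) (g (yOf b)) * (twist (yOf b) (ξs v i) * twist (zOf b) (ζs v i)))
  rw [Fintype.piFinset_univ] at hprod
  rw [← hprod]
  simp_rw [sum_block]
  rw [Finset.prod_mul_distrib, Finset.prod_const, Finset.card_univ, Fintype.card_fin, ← mul_assoc]
  congr 1
  calc (1 / 2 : ℝ) ^ (m * (Q + r)) * (2 ^ r) ^ m = (1 / 2) ^ (m * Q) * ((1 / 2 : ℝ) ^ (m * r) * 2 ^ (m * r)) := by
        rw [mul_add, pow_add, ← pow_mul, Nat.mul_comm r m]; ring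
    _ = (1 / 2) ^ (m * Q) := by rw [← mul_pow]; norm_num

/-! ### The periodic case -/

/-- **Simon's cancellation**: if `g` is invariant under `y ↦ y ⊕ s` and `ξ · s` is odd, then
`S(ξ, ζ) = 0` for every `ζ` (pair `y` with `y ⊕ s`). [cite: Simon1997, §3.1] -/
theorem S1_eq_zero_of_periodic {s : Fin Q → Bool} (hg : ∀ y, g (fun i => y i ^^ s i) = g y)
    {ξ : Fin Q → Bool} (hodd : twist s ξ = -1) (ζ : Fin r → Bool) : S1 g ξ ζ = 0 := by
  set τ : (Fin Q → Bool) → (Fin Q → Bool) := fun y i => y i ^^ s i with hτ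
  have hinv : Function.Involutive τ := fun y => by funext i; simp [hτ]
  have hS : S1 g ξ ζ = -S1 g ξ ζ := by
    unfold S1
    conv_lhs => rw [← Equiv.sum_comp hinv.toPerm]
    rw [← sum_neg_distrib]
    refine sum_congr rfl fun y _ => ?_
    change (if g (τ y) = ζ then twist (τ y) ξ else 0) = -(if g y = ζ then twist y ξ else 0)
    rw [show g (τ y) = g y from hg y, show twist (τ y) ξ = twist y ξ * twist s ξ from twist_xor_left y s ξ, hodd]
    split_ifs <;> ring
  linarith

/-- **In the periodic case the amplitude vanishes off the accepted samples**: if `g` has the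
nonzero xor-mask `s`, every content whose samples do not all have even overlap with some nonzero
vector — in particular with `s` — has amplitude `0`. [cite: Simon1997, §3.1] -/
theorem amp_eq_zero_of_periodic {s : Fin Q → Bool} (hs : s ≠ fun _ => false) (hg : ∀ y, g (fun i => y i ^^ s i) = g y)
    {v : Fin (m * (Q + r)) → Bool} (hv : ¬ MissesBasis (ξs v)) : amp g v = 0 := by
  have h : ∃ i, ¬ EvenOverlap s (ξs v i) := by
    by_contra hall
    push Not at hall
    exact hv (missesBasis_of_forall_even hs hall)
  obtain ⟨i, hi⟩ := h
  rw [amp_eq, Finset.prod_eq_zero (Finset.mem_univ i) (S1_eq_zero_of_periodic g hg ((twist_eq_neg_one_iff _ _).2 hi) _),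
    mul_zero]

/-! ### The injective case -/

/-- In the injective case `∑_ζ S(ξ, ζ)² = 2^Q` for every `ξ`. [cite: Simon1997, §3.1] -/
theorem sum_S1_sq_of_injective (hg : Function.Injective g) (ξ : Fin Q → Bool) :
    ∑ ζ : Fin r → Bool, S1 g ξ ζ ^ 2 = (2 : ℝ) ^ Q := by
  classical
  have hval : ∀ ζ, S1 g ξ ζ ^ 2 = if ζ ∈ univ.image g then 1 else 0 := by
    intro ζ
    split_ifs with hζ
    · obtain ⟨y, -, rfl⟩ := mem_image.1 hζ
      unfold S1
      rw [sum_eq_single y]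
      · rw [if_pos rfl, twist_sq]
      · intro y' _ hy'; rw [if_neg (fun h => hy' (hg h))]
      · intro h; exact absurd (mem_univ y) h
    · unfold S1
      rw [sum_eq_zero]
      · ring
      · intro y _; rw [if_neg]; exact fun h => hζ (mem_image.2 ⟨y, mem_univ _, h⟩)
  simp_rw [hval]
  rw [← sum_filter, sum_const, nsmul_eq_mul, mul_one]
  have : (univ.filter fun ζ => ζ ∈ univ.image g) = univ.image g := by ext ζ; simp
  rw [this, card_image_of_injective _ hg, card_univ, Fintype.card_fun, Fintype.card_bool, Fintype.card_fin]
  push_cast; rfl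

/-- The contents as pairs (samples, values). [folklore] -/
def eSV : (Fin (m * (Q + r)) → Bool) ≃ (Fin m → Fin Q → Bool) × (Fin m → Fin r → Bool) :=
  eBlk.trans ((Equiv.arrowCongr (Equiv.refl (Fin m)) eYZ).trans (Equiv.arrowProdEquivProdArrow _ _ _))

/-- The components of `eSV`. [folklore] -/
@[simp] theorem eSV_apply (v : Fin (m * (Q + r)) → Bool) : eSV v = (ξs v, ζs v) := by
  ext i j <;> rfl

/-- **In the injective case the accepted samples have small mass**:
`∑_{v : MissesBasis (ξ v)} amp v ² ≤ (2^Q - 1) 2^{(Q-1) m} / 2^{Qm}` (the samples are independent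
and uniform, and `#MissesBasis ≤ (2^Q - 1) 2^{(Q-1)m}` by the union bound over the nonzero vectors).
[cite: Simon1997, §3.1 (last paragraph)] -/
theorem sum_amp_sq_missesBasis_of_injective (hg : Function.Injective g) :
    ∑ v : Fin (m * (Q + r)) → Bool, (if MissesBasis (ξs v) then amp g v ^ 2 else 0) ≤
      ((2 ^ Q - 1) * 2 ^ ((Q - 1) * m) : ℕ) / (2 : ℝ) ^ (Q * m) := by
  classical
  -- re-index by (samples, values) and sum out the values
  have h1 : (∑ v : Fin (m * (Q + r)) → Bool, (if MissesBasis (ξs v) then amp g v ^ 2 else 0)) =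
      ∑ ξ : Fin m → Fin Q → Bool, if MissesBasis ξ then ((1 / 2 : ℝ) ^ (m * Q)) ^ 2 * (2 : ℝ) ^ (Q * m) else 0 := by
    rw [← Fintype.sum_equiv eSV.symm (fun p : (Fin m → Fin Q → Bool) × (Fin m → Fin r → Bool) =>
        if MissesBasis p.1 then ((1 / 2 : ℝ) ^ (m * Q) * ∏ i, S1 g (p.1 i) (p.2 i)) ^ 2 else 0) _ (fun p => by
          obtain ⟨ξ, ζ⟩ := p
          have e : eSV (eSV.symm (ξ, ζ)) = (ξ, ζ) := Equiv.apply_symm_apply _ _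
          rw [eSV_apply, Prod.mk.injEq] at e
          simp only [e.1, amp_eq, e.2]),
      Fintype.sum_prod_type]
    refine Finset.sum_congr rfl fun ξ _ => ?_
    split_ifs with hξ
    · simp_rw [mul_pow, ← Finset.prod_pow, ← Finset.mul_sum]
      congr 1
      have hprod := Finset.prod_univ_sum (fun _ : Fin m => (Finset.univ : Finset (Fin r → Bool))) (fun i ζ => S1 g (ξ i) ζ ^ 2)
      rw [Fintype.piFinset_univ] at hprod
      rw [← hprod]
      simp_rw [sum_S1_sq_of_injective g hg]
      rw [Finset.prod_const, Finset.card_univ, Fintype.card_fin, ← pow_mul]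
    · simp
  rw [h1, ← Finset.sum_filter, Finset.sum_const, nsmul_eq_mul]
  have hc := card_filter_missesBasis_le (k := m) (n := Q)
  have hpow : ((1 / 2 : ℝ) ^ (m * Q)) ^ 2 * (2 : ℝ) ^ (Q * m) = 1 / (2 : ℝ) ^ (Q * m) := by
    rw [← pow_mul, one_div_pow, Nat.mul_comm m Q, show Q * m * 2 = Q * m + Q * m by ring, pow_add]
    field_simp
  rw [hpow, mul_one_div]
  exact div_le_div_of_nonneg_right (by exact_mod_cast hc) (by positivity)

end SimonBlocks

end Literature.Computability.QuantumComplexity
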